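/-
Copyright (c) 2026 the pub-hodgecm-mathlib formalisation cell (harness21).  Prover seat hodgecm-mathlib-F0P3a-p01 (g39), explicit-unit SUPPORTS-ONLY on h413, req620 Track A
«(D-RAM) FOUR-FRAME» squad ((β₂) road (R-36), LANE A (Unr-K): the ABSTRACT window reduction of lane A's live row `2b + ℓ₀ = m` on the Unr-K atlas — FILE (A) of the
‹ROW-A.v2› CORE-style cut, β₂ sub-dealer LH4-p04 (g10) note (ii) 2026-09-05T01:56:47Z), 2026-09-05.
-/
import Summits.HodgeConjecture.HodgeConjecture.Theorems.F0P3cDyRamRowWindowReduction   -- ★ p862963 (LH4-p04 (g9)): the even-row kit; brings ★ p862919 `sum_range_ite_le_eq`, `sum_range_eq_sum_window`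
import HarnessLib

/-!
# Crux `H413`, line LH4 «(D-RAM) FOUR-FRAME» — (β₂) road, LANE A (Unr-K), FILE (A): «THE ABSTRACT ROW-WINDOW REDUCTION ON THE Unr-K ATLAS» (pure `Finset` algebra over `ℤ`)

Cell `hodgecm-mathlib` (D-0151), FLOOR 0, crux item H413 = `stmt-HodgeConjecture-24833`, route of record `HCCMUnconditional`; squad F0∕P3c∕LH4; lane
`--supports stmt-HodgeConjecture-24833 --as helper` (count-neutral).  THEOREMS ONLY (no `def`, no instance, no notation, no `sorry`, default heartbeats).
WHY (LANE-A BOARD v4 `F0/P3a/F0P3a-p01/g38/laneA/LANE-A-BOARD.v4.F0P3ap01g38.md` §1.6; β₂ sub-dealer LH4-p04 (g10) note (ii) «cut ‹ROW-A.v2› CORE-style»).  Lane A's last row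
letter ‹ROW-A.v2› (b16a9a55) compares the two literals' guarded row sums filtered at the ℓ₀-shifted live row `2b + ℓ₀ = m` (`ℓ₀ = d % 2`).  In the Unr-K geography
(★ p861798 `…ConeCellEmptyAtlas` §3, u-free, `1 ≤ d`, NO parity law) the HYPERBOLIC literal carries plane lattices only on the TOWER `j = b + d + 2i` (`j < b + d` and
`(j − b − d)` odd are empty) and the ANISOTROPIC literal only on its HEAD `j + 1 = b + d` — unlike lane B's even offsets from `c = 0` on both literals (★ p862963 ∕ ★ p863898),
so lane A needs its own abstract reduction.  THIS FILE, ABSTRACTLY (no lattice, no field): GIVEN those window vanishings, the vanishing beyond the range `jl < j + b`, the box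
bounds, and the WINDOWED identity «HYP TOWER SUM = ANISO HEAD» `Σ_{i < (jl + ℓ + 2 − m − d) ∕ 2} X_H (b + d + 2i) b = Σ_{i < (if m + d ≤ jl + ℓ + 1 then 1 else 0)} X_A (b + d − 1 + 2i) b` at the
(at most one) depth `b` with `1 ≤ b`, `2b + ℓ = m`, the two filtered guarded row sums agree.  The tower cell `i` is in range iff `2b + d + 2i ≤ jl` iff `i < (jl + ℓ + 2 − m − d) ∕ 2`;
the head is in range iff `2b + d − 1 ≤ jl` iff `m + d ≤ jl + ℓ + 1` (ℕ-subtraction truncates exactly the empty windows).  Census behind the identity: F0P3-p01 (g37)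
`F0/P3/F0P3-p01/g37/beta2H/LEDGER-d3-UnrK.v1.F0P3p01g37.txt` (d = 3, q = 2: key (16,9) `b = 4`: ANISO head (6,8) PURE −1536 ‖ HYP tower (7,8) PURE −1536, (9,8) balanced;
key (14,9): all balanced).
* `sum_filter_two_mul_add_eq` — the filter `2b + ℓ = m` keeps at most the depth `b = (m − ℓ) ∕ 2`;
* `sum_ite_eq_sum_window_unrK_hyper` — HYP literal: guarded level sum at the row depth = its tower window sum;
* `sum_ite_eq_sum_window_unrK_aniso` — ANISO literal: guarded level sum at the row depth = its head window sum (one cell when in range, else empty);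
* `rowSumA_eq_rowSumA_of_window` — the reduction; instantiated by `F0P3cDyRamRowAOfCoreA :: rowA₂_of_coreA` at the two literals (ℓ := d % 2).
HONEST LABEL.  Arithmetic only; nothing printed is asserted; β₂ ∕ ‹ROW-A.v2› ∕ ‹CORE-A› stay HYPOTHESES; `HC_CM` is proved only modulo the 7 printed citations (2 remaining named
inputs: hLiu418 = `stmt-HodgeConjecture-24832`, h413 = `stmt-HodgeConjecture-24833`) until rung 0 closes.
References: [Kottwitz1986BaseChangeUnits] §1 pp. 240–241 (cell-by-cell lattice bookkeeping) · [Rogawski1990] §4.9 Prop. 4.9.1 (b) p. 55 · [Flicker1998UnitaryFL] Prop. 7 p. 84.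
-/

set_option autoImplicit false

namespace Summit.HodgeConjecture.HodgeConjecture.Cruxes.H413.F0P3cDyRamRowWindowReductionUnrK

open Finset Summit.HodgeConjecture.HodgeConjecture.Cruxes.H413.F0P3cDyRamRowSumWindowArithmetic

/-- **THE ℓ₀-SHIFTED ROW FILTER KEEPS AT MOST ONE TUBE DEPTH.**  `Σ_{b ∈ S, 2b + ℓ = m} G b = if ℓ ≤ m ∧ (m − ℓ) % 2 = 0 ∧ (m − ℓ) ∕ 2 ∈ S then G ((m − ℓ) ∕ 2) else 0`.
[cite: Kottwitz1986BaseChangeUnits, §1 pp. 240–241] -/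
theorem sum_filter_two_mul_add_eq (S : Finset ℕ) (G : ℕ → ℤ) (m ℓ : ℕ) :
    ∑ b ∈ S.filter (fun b => 2 * b + ℓ = m), G b = if ℓ ≤ m ∧ (m - ℓ) % 2 = 0 ∧ (m - ℓ) / 2 ∈ S then G ((m - ℓ) / 2) else 0 := by
  by_cases hpar : ℓ ≤ m ∧ (m - ℓ) % 2 = 0
  · obtain ⟨hle, hev⟩ := hpar
    have hS : S.filter (fun b => 2 * b + ℓ = m) = S.filter (fun b => b = (m - ℓ) / 2) :=
      filter_congr fun b _ => by omega
    rw [hS, filter_eq' S ((m - ℓ) / 2)]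
    by_cases hmem : (m - ℓ) / 2 ∈ S
    · rw [if_pos hmem, if_pos ⟨hle, hev, hmem⟩, sum_singleton]
    · rw [if_neg hmem, if_neg (fun h => hmem h.2.2), sum_empty]
  · rw [if_neg (fun h => hpar ⟨h.1, h.2.1⟩)]
    exact sum_eq_zero fun b hb => absurd (mem_filter.1 hb).2 fun hbm => hpar ⟨by omega, by omega⟩

/-- **HYPERBOLIC LITERAL ON THE Unr-K ATLAS: THE GUARDED LEVEL SUM AT THE ROW DEPTH `b` (`2b + ℓ = m`) IS ITS TOWER WINDOW SUM** (cells `j = b + d + 2i`, `i < (jl + ℓ + 2 − m − d) ∕ 2`;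
vanishing below the tower base `j < b + d`, at odd offset `(j − b − d)` from it, and beyond the range `jl < j + b`). [cite: Flicker1998UnitaryFL, Prop. 7 p. 84] [cite: Kottwitz1986BaseChangeUnits, §1 pp. 240–241] -/
theorem sum_ite_eq_sum_window_unrK_hyper (P : ℕ → Prop) [DecidablePred P] (X : ℕ → ℕ → ℤ) {J jl m b d ℓ : ℕ}
    (hP : ∀ j, P j ↔ j ≤ jl) (hJ : jl ≤ J) (hb : 2 * b + ℓ = m)
    (h1 : ∀ j, j < b + d → X j b = 0) (h2 : ∀ j, (j - b - d) % 2 = 1 → X j b = 0) (h3 : ∀ j, jl < j + b → X j b = 0) :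
    ∑ j ∈ range (J + 1), (if P j then X j b else 0) = ∑ i ∈ range ((jl + ℓ + 2 - m - d) / 2), X (b + d + 2 * i) b := by
  have hguard : ∑ j ∈ range (J + 1), (if P j then X j b else 0) = ∑ j ∈ range (J + 1), (if j ≤ jl then X j b else 0) :=
    sum_congr rfl fun j _ => by by_cases hj : j ≤ jl <;> simp [hj, hP j]
  rw [hguard, sum_range_ite_le_eq _ hJ]
  refine sum_range_eq_sum_window (fun j => X j b) (b + d) _ jl (fun i hi => by omega) fun j _ hnot => ?_
  rcases Nat.lt_or_ge j (b + d) with hjb | hbj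
  · exact h1 j hjb
  · by_cases hpar : (j - b - d) % 2 = 1
    · exact h2 j hpar
    · -- `j = b + d + 2 i₀` with `i₀ = (j − b − d) ∕ 2` NOT below the window bound ⇒ beyond the range
      have hi₀ : ¬ (j - b - d) / 2 < (jl + ℓ + 2 - m - d) / 2 := fun hlt => hnot _ hlt (by omega)
      exact h3 j (by omega)

/-- **ANISOTROPIC LITERAL ON THE Unr-K ATLAS: THE GUARDED LEVEL SUM AT THE ROW DEPTH `b` (`2b + ℓ = m`, `1 ≤ b`) IS ITS HEAD WINDOW SUM** — the one cell `j = b + d − 1` when in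
range (`m + d ≤ jl + ℓ + 1`), the empty window otherwise: `Σ_{i < (if m + d ≤ jl + ℓ + 1 then 1 else 0)} X (b + d − 1 + 2i) b` (β₂ sub-dealer LH4-p04 (g10) 02:41:09Z: a SUM on both
sides, the head count spelled once; vanishing off the head `b + d ≠ j + 1` and beyond the range `jl < j + b`). [cite: Flicker1998UnitaryFL, Prop. 7 p. 84] [cite: Kottwitz1986BaseChangeUnits, §1 pp. 240–241] -/
theorem sum_ite_eq_sum_window_unrK_aniso (P : ℕ → Prop) [DecidablePred P] (X : ℕ → ℕ → ℤ) {J jl m b d ℓ : ℕ}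
    (hP : ∀ j, P j ↔ j ≤ jl) (hJ : jl ≤ J) (hb : 2 * b + ℓ = m) (hb1 : 1 ≤ b)
    (h1 : ∀ j, b + d ≠ j + 1 → X j b = 0) (h3 : ∀ j, jl < j + b → X j b = 0) :
    ∑ j ∈ range (J + 1), (if P j then X j b else 0) = ∑ i ∈ range (if m + d ≤ jl + ℓ + 1 then 1 else 0), X (b + d - 1 + 2 * i) b := by
  have hguard : ∑ j ∈ range (J + 1), (if P j then X j b else 0) = ∑ j ∈ range (J + 1), (if j ≤ jl then X j b else 0) :=
    sum_congr rfl fun j _ => by by_cases hj : j ≤ jl <;> simp [hj, hP j]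
  rw [hguard, sum_range_ite_le_eq _ hJ]
  refine sum_range_eq_sum_window (fun j => X j b) (b + d - 1) _ jl (fun i hi => ?_) fun j _ hnot => ?_
  · -- in the window: only `i = 0`, and then the head is in range
    by_cases hin : m + d ≤ jl + ℓ + 1
    · rw [if_pos hin] at hi; omega
    · rw [if_neg hin] at hi; omega
  · by_cases hjh : b + d = j + 1
    · -- the head itself, but not in the window ⇒ the window is empty ⇒ the head is beyond the range
      by_cases hin : m + d ≤ jl + ℓ + 1
      · exact absurd (show j = b + d - 1 + 2 * 0 by omega) (hnot 0 (by rw [if_pos hin]; exact one_pos))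
      · exact h3 j (by omega)
    · exact h1 j hjh

/-- **THE ABSTRACT ROW-WINDOW REDUCTION ON THE Unr-K ATLAS** — two families `X_H X_A`, common guard `P j ⟺ j ≤ jl` (`jl ≤ J`), the Unr-K window vanishings (HYP: below the tower base,
odd offset from it; ANISO: off the head), the vanishing beyond the range `jl < j + b` and the box bounds on both literals, and the windowed identity «HYP TOWER SUM = ANISO HEAD»
at every `b` with `1 ≤ b`, `2b + ℓ = m` ⟹ the two guarded row sums filtered at `2b + ℓ = m` agree.
[cite: Kottwitz1986BaseChangeUnits, §1 pp. 240–241] [cite: Rogawski1990, §4.9 Prop. 4.9.1 (b) p. 55] [cite: Flicker1998UnitaryFL, Prop. 7 p. 84] -/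
theorem rowSumA_eq_rowSumA_of_window (P : ℕ → Prop) [DecidablePred P] (XH XA : ℕ → ℕ → ℤ) (J R R' jl m d ℓ : ℕ)
    (hP : ∀ j, P j ↔ j ≤ jl) (hJ : jl ≤ J)
    (h1H : ∀ b j, 1 ≤ b → 2 * b + ℓ = m → j < b + d → XH j b = 0) (h2H : ∀ b j, 1 ≤ b → 2 * b + ℓ = m → (j - b - d) % 2 = 1 → XH j b = 0)
    (h3H : ∀ b j, 1 ≤ b → 2 * b + ℓ = m → jl < j + b → XH j b = 0) (hRH : ∀ b j, 1 ≤ b → 2 * b + ℓ = m → P j → XH j b ≠ 0 → b ≤ R)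
    (h1A : ∀ b j, 1 ≤ b → 2 * b + ℓ = m → b + d ≠ j + 1 → XA j b = 0)
    (h3A : ∀ b j, 1 ≤ b → 2 * b + ℓ = m → jl < j + b → XA j b = 0) (hRA : ∀ b j, 1 ≤ b → 2 * b + ℓ = m → P j → XA j b ≠ 0 → b ≤ R')
    (hcore : ∀ b, 1 ≤ b → 2 * b + ℓ = m →
      ∑ i ∈ range ((jl + ℓ + 2 - m - d) / 2), XH (b + d + 2 * i) b = ∑ i ∈ range (if m + d ≤ jl + ℓ + 1 then 1 else 0), XA (b + d - 1 + 2 * i) b) :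
    ∑ b ∈ (Icc 1 R).filter (fun b => 2 * b + ℓ = m), ∑ j ∈ range (J + 1), (if P j then XH j b else 0) =
      ∑ b ∈ (Icc 1 R').filter (fun b => 2 * b + ℓ = m), ∑ j ∈ range (J + 1), (if P j then XA j b else 0) := by
  rw [sum_filter_two_mul_add_eq, sum_filter_two_mul_add_eq]
  by_cases hpar : ℓ ≤ m ∧ (m - ℓ) % 2 = 0
  swap
  · rw [if_neg (fun h => hpar ⟨h.1, h.2.1⟩), if_neg (fun h => hpar ⟨h.1, h.2.1⟩)]
  obtain ⟨hle, hev⟩ := hpar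
  have hb : 2 * ((m - ℓ) / 2) + ℓ = m := by omega
  by_cases hb1 : 1 ≤ (m - ℓ) / 2
  swap
  · have hH : (m - ℓ) / 2 ∉ Icc 1 R := fun h => hb1 (mem_Icc.1 h).1
    have hA : (m - ℓ) / 2 ∉ Icc 1 R' := fun h => hb1 (mem_Icc.1 h).1
    rw [if_neg (fun h => hH h.2.2), if_neg (fun h => hA h.2.2)]
  -- both guarded row sums are their windows, which agree by `hcore`
  have eH := sum_ite_eq_sum_window_unrK_hyper P XH (J := J) (d := d) hP hJ hb
    (fun j hj => h1H _ j hb1 hb hj) (fun j hp => h2H _ j hb1 hb hp) (fun j hj => h3H _ j hb1 hb hj)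
  have eA := sum_ite_eq_sum_window_unrK_aniso P XA (J := J) (d := d) hP hJ hb hb1
    (fun j hj => h1A _ j hb1 hb hj) (fun j hj => h3A _ j hb1 hb hj)
  have key : ∑ j ∈ range (J + 1), (if P j then XH j ((m - ℓ) / 2) else 0) = ∑ j ∈ range (J + 1), (if P j then XA j ((m - ℓ) / 2) else 0) := by
    rw [eH, eA]; exact hcore _ hb1 hb
  -- outside a box the guarded row sum vanishes termwise (box bound), on either side
  have zH : (m - ℓ) / 2 ∉ Icc 1 R → ∑ j ∈ range (J + 1), (if P j then XH j ((m - ℓ) / 2) else 0) = 0 := fun hn =>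
    sum_eq_zero fun j _ => by
      split_ifs with hp
      · by_contra hne; exact hn (mem_Icc.2 ⟨hb1, hRH _ j hb1 hb hp hne⟩)
      · rfl
  have zA : (m - ℓ) / 2 ∉ Icc 1 R' → ∑ j ∈ range (J + 1), (if P j then XA j ((m - ℓ) / 2) else 0) = 0 := fun hn =>
    sum_eq_zero fun j _ => by
      split_ifs with hp
      · by_contra hne; exact hn (mem_Icc.2 ⟨hb1, hRA _ j hb1 hb hp hne⟩)
      · rfl
  by_cases hH : (m - ℓ) / 2 ∈ Icc 1 R <;> by_cases hA : (m - ℓ) / 2 ∈ Icc 1 R'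
  · rw [if_pos ⟨hle, hev, hH⟩, if_pos ⟨hle, hev, hA⟩]; exact key
  · rw [if_pos ⟨hle, hev, hH⟩, if_neg (fun h => hA h.2.2), key]; exact zA hA
  · rw [if_neg (fun h => hH h.2.2), if_pos ⟨hle, hev, hA⟩, ← key]; exact (zH hH).symm
  · rw [if_neg (fun h => hH h.2.2), if_neg (fun h => hA h.2.2)]

end Summit.HodgeConjecture.HodgeConjecture.Cruxes.H413.F0P3cDyRamRowWindowReductionUnrK
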